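import Summits.HodgeConjecture.HodgeConjecture.Theorems.K2E1ChiContinuedEisensteinMiddleResidueCMThree   -- ★ p862783 (K2E1-p16): the section-shaped constant-term letter `hE3` and scattering-pole letter `hψ` currency; brings `borelConstantTerm`, `borelHeight`, `quasiSplit`
import HarnessLib

/-!
# K2·E1 — `K2E1ChiBorelConstantTermMiddleResidueCMThree`: THE CONSTANT TERM OF THE RESIDUE — `(z − z₀)·Ẽ(z)_B(g) → ρψ(g)·H(g)^{2−z₀}`, and at the middle pole `Ψ = φ̃·H^{1/2}`

Track B ∕ K2-LIT, crux h413 = `stmt-HodgeConjecture-24833`, route `HCCMUnconditional`; cell `hodgecm-mathlib`, R90-TF section S8, deal S8-R83 (2) (R90-CS-plan (g2)) «CT-RESIDUE SHAPE →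
K2E2-p12 (g8)»: pays the (ii) letters `hCT`∕`hΨ` of ★ p862780 `R90S8ResGMidBlockNeBotOfLettersU3.resGMidBlock_ne_bot_of_letters` (the (V) seam) from the section-shaped constant-term
letter of the continued family (★ p862783 `K2E1ChiContinuedEisensteinMiddleResidueCMThree` currency: `Ẽ(z)_B(g) = φ(g)·H(g)^z + ψ_z(g)·H(g)^{2−z}` on `D`, `D ∈ 𝓝[≠] z₀`) and the
scattering-pole letter `(z − z₀)·ψ_z(g) → ρψ(g)` (at the middle pole `ρψ = ρ·φ̃` with `ρ` the ★ F5 scalar residue and `φ̃` the intertwined section).  THEOREMS ONLY (no `def`, no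
`instance`, no notation, no named-fact hypothesis, no `sorry`; default heartbeats); count-neutral; generic `quasiSplit F E c N` and pole `z₀` in §1, the middle pole `z₀ = 3/2` in §2.

THE MATHEMATICS ([MoeglinWaldspurger1995, II.1.7, IV.1.11]).  Multiply the constant-term identity by `(z − z₀)` and let `z → z₀` (`z ≠ z₀`): the first summand `(z − z₀)·φ(g)·H^z → 0`
(`z ↦ H^z` continuous, `H(g) > 0`), the second `((z − z₀)ψ_z(g))·H^{2−z} → ρψ(g)·H^{2−z₀}`.  At `z₀ = 3/2`: `2 − 3/2 = 1/2`, so with `ρψ = ρ·φ̃` the limit is `ρ·Ψ(g)`, `Ψ(g) := φ̃(g)·H(g)^{1/2}`,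
and `Ψ(g₀) ≠ 0 ⟺ φ̃(g₀) ≠ 0` (`H^{1/2} ≠ 0`).
* §1 **`tendsto_sub_mul_borelConstantTerm_of_section`** — any pole `z₀`: `(z − z₀)·Ẽ(z)_B(g) → ρψ(g)·H(g)^{2−z₀}`.
* §2 **`tendsto_sub_mul_borelConstantTerm_middle`** — `z₀ = 3/2`, `ρψ = ρ·φ̃`: the (V) seam's `hCT` with `Ψ g = φ̃ g·H(g)^{1/2}`; **`middlePsi_ne_zero`** — its `hΨ` from `φ̃ g₀ ≠ 0`.
HONEST LABEL: HC_CM is proved only modulo the 7 printed citations (2 remaining named inputs: hLiu418 = `stmt-HodgeConjecture-24832`, h413 = `stmt-HodgeConjecture-24833`) until rung 0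
closes; count-neutral helper; pays a letter of the (V) seam, closes no socket; visible after this file on the (ii) line: the section-shaped `hE3` and the scattering-pole letter `hψ`
(LAYER-2∕G9₃ exports) and `φ̃(g₀) ≠ 0`.

## References
* [MoeglinWaldspurger1995] C. Mœglin, J.-L. Waldspurger, *Spectral Decomposition and Eisenstein Series* (1995), II.1.7 (constant terms), IV.1.11 (residues of Eisenstein series).
* [Rogawski1990] J. D. Rogawski, *Automorphic Representations of Unitary Groups in Three Variables* (1990), §13.9 (ii) p. 229.
-/

set_option autoImplicit false
-- the mandated namespace repeats the single-problem summit's segment (`HodgeConjecture.HodgeConjecture`)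
set_option linter.dupNamespace false

noncomputable section

open MeasureTheory Measure NumberField IsDedekindDomain Set Filter Topology Metric
open scoped ENNReal NNReal
open Literature.NumberTheory.Automorphic Literature.NumberTheory.Automorphic.UnitaryGroup AdelicGroupData
open Summit.HodgeConjecture.HodgeConjecture.Cruxes.H413.K2E1BLBorelSpacesU2Defs

namespace Summit.HodgeConjecture.HodgeConjecture.Cruxes.H413.K2E1ChiBorelConstantTermMiddleResidueCMThree

variable {F E : Type} [Field F] [NumberField F] [Field E] [NumberField E] [Algebra F E] {c : E ≃ₐ[F] E} {N : ℕ} [NeZero N]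

/-! ## §1 Any pole `z₀`: the constant term of the residue is `ρψ·H^{2−z₀}` -/

/-- **`(z − z₀)·Ẽ(z)_B(g) → ρψ(g)·H(g)^{2−z₀}`** along `𝓝[≠] z₀`, from the section-shaped constant-term letter `Ẽ(z)_B(g) = φ(g)H(g)^z + ψ_z(g)H(g)^{2−z}` on `D ∈ 𝓝[≠] z₀` and the
scattering-pole letter `(z − z₀)·ψ_z(g) → ρψ(g)` (the `φ`-summand dies with the factor `z − z₀`; `z ↦ H(g)^z` is continuous since `H(g) > 0`). [cite: MoeglinWaldspurger1995, II.1.7, IV.1.11] -/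
theorem tendsto_sub_mul_borelConstantTerm_of_section [MeasurableSpace ↥(adelicUnipotent F E c N)] (ν : Measure ↥(adelicUnipotent F E c N))
    (𝓕 : Set ↥(adelicUnipotent F E c N)) {z₀ : ℂ} (Ec : ℂ → (quasiSplit F E c N).Adelic → ℂ) {D : Set ℂ} (hD : ∀ᶠ z in 𝓝[≠] z₀, z ∈ D)
    (φ : (quasiSplit F E c N).Adelic → ℂ) (ψ : ℂ → (quasiSplit F E c N).Adelic → ℂ) (ρψ : (quasiSplit F E c N).Adelic → ℂ)
    (hψ : ∀ g, Tendsto (fun z : ℂ => (z - z₀) * ψ z g) (𝓝[≠] z₀) (𝓝 (ρψ g)))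
    (hE3 : ∀ z ∈ D, ∀ g : (quasiSplit F E c N).Adelic,
      borelConstantTerm ν 𝓕 (Ec z) g = φ g * (((borelHeight g : ℝ≥0) : ℝ) : ℂ) ^ z + ψ z g * (((borelHeight g : ℝ≥0) : ℝ) : ℂ) ^ (2 - z))
    (g : (quasiSplit F E c N).Adelic) :
    Tendsto (fun z : ℂ => (z - z₀) * borelConstantTerm ν 𝓕 (Ec z) g) (𝓝[≠] z₀) (𝓝 (ρψ g * (((borelHeight g : ℝ≥0) : ℝ) : ℂ) ^ (2 - z₀))) := by
  have hH : (((borelHeight g : ℝ≥0) : ℝ) : ℂ) ∈ Complex.slitPlane := Complex.ofReal_mem_slitPlane.2 (NNReal.coe_pos.2 (borelHeight_pos g))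
  -- `z ↦ H^z` and `z ↦ H^{2−z}` are continuous
  have hc1 : Continuous fun z : ℂ => (((borelHeight g : ℝ≥0) : ℝ) : ℂ) ^ z := continuous_const.cpow continuous_id fun _ => hH
  have hc2 : Continuous fun z : ℂ => (((borelHeight g : ℝ≥0) : ℝ) : ℂ) ^ (2 - z) := continuous_const.cpow (continuous_const.sub continuous_id) fun _ => hH
  -- the two summands
  have h1 : Tendsto (fun z : ℂ => (z - z₀) * (φ g * (((borelHeight g : ℝ≥0) : ℝ) : ℂ) ^ z)) (𝓝[≠] z₀) (𝓝 0) := by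
    have hz : Tendsto (fun z : ℂ => z - z₀) (𝓝[≠] z₀) (𝓝 0) := by
      have h : Tendsto (fun z : ℂ => z - z₀) (𝓝 z₀) (𝓝 (z₀ - z₀)) := (continuous_sub_right z₀).tendsto z₀
      rw [sub_self] at h
      exact tendsto_nhdsWithin_of_tendsto_nhds h
    have hb : Tendsto (fun z : ℂ => φ g * (((borelHeight g : ℝ≥0) : ℝ) : ℂ) ^ z) (𝓝[≠] z₀) (𝓝 (φ g * (((borelHeight g : ℝ≥0) : ℝ) : ℂ) ^ z₀)) :=
      tendsto_nhdsWithin_of_tendsto_nhds ((continuous_const.mul hc1).tendsto z₀)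
    simpa only [zero_mul] using hz.mul hb
  have h2 : Tendsto (fun z : ℂ => (z - z₀) * ψ z g * (((borelHeight g : ℝ≥0) : ℝ) : ℂ) ^ (2 - z)) (𝓝[≠] z₀)
      (𝓝 (ρψ g * (((borelHeight g : ℝ≥0) : ℝ) : ℂ) ^ (2 - z₀))) :=
    (hψ g).mul (tendsto_nhdsWithin_of_tendsto_nhds (hc2.tendsto z₀))
  have hsum := h1.add h2
  rw [zero_add] at hsum
  refine hsum.congr' ?_
  filter_upwards [hD] with z hz
  rw [hE3 z hz g]
  ring

/-! ## §2 The middle pole `z₀ = 3/2`: `Ψ = φ̃·H^{1/2}` -/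

/-- **THE (V) SEAM'S `hCT` AT THE MIDDLE POLE**: with the scattering-pole letter factorised as `(z − 3/2)·ψ_z(g) → ρ·φ̃(g)` (`ρ` the ★ F5 scalar residue, `φ̃` the intertwined section at the
middle point), `(z − 3/2)·Ẽ(z)_B(g) → ρ·Ψ(g)` with `Ψ(g) = φ̃(g)·H(g)^{1/2}` (`2 − 3/2 = 1/2`). [cite: MoeglinWaldspurger1995, IV.1.11] [cite: Rogawski1990, §13.9 (ii) p. 229] -/
theorem tendsto_sub_mul_borelConstantTerm_middle [MeasurableSpace ↥(adelicUnipotent F E c N)] (ν : Measure ↥(adelicUnipotent F E c N))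
    (𝓕 : Set ↥(adelicUnipotent F E c N)) (Ec : ℂ → (quasiSplit F E c N).Adelic → ℂ) {D : Set ℂ} (hD : ∀ᶠ z in 𝓝[≠] ((3 : ℂ) / 2), z ∈ D)
    (φ : (quasiSplit F E c N).Adelic → ℂ) (ψ : ℂ → (quasiSplit F E c N).Adelic → ℂ) (φt : (quasiSplit F E c N).Adelic → ℂ) {ρ : ℂ}
    (hψ : ∀ g, Tendsto (fun z : ℂ => (z - (3 : ℂ) / 2) * ψ z g) (𝓝[≠] ((3 : ℂ) / 2)) (𝓝 (ρ * φt g)))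
    (hE3 : ∀ z ∈ D, ∀ g : (quasiSplit F E c N).Adelic,
      borelConstantTerm ν 𝓕 (Ec z) g = φ g * (((borelHeight g : ℝ≥0) : ℝ) : ℂ) ^ z + ψ z g * (((borelHeight g : ℝ≥0) : ℝ) : ℂ) ^ (2 - z))
    (g : (quasiSplit F E c N).Adelic) :
    Tendsto (fun z : ℂ => (z - (3 : ℂ) / 2) * borelConstantTerm ν 𝓕 (Ec z) g) (𝓝[≠] ((3 : ℂ) / 2))
      (𝓝 (ρ * (φt g * (((borelHeight g : ℝ≥0) : ℝ) : ℂ) ^ ((1 : ℂ) / 2)))) := by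
  have h := tendsto_sub_mul_borelConstantTerm_of_section ν 𝓕 Ec hD φ ψ (fun g => ρ * φt g) hψ hE3 g
  have h12 : (2 : ℂ) - (3 : ℂ) / 2 = (1 : ℂ) / 2 := by norm_num
  rw [h12] at h
  simpa only [mul_assoc] using h

/-- **THE (V) SEAM'S `hΨ`**: `Ψ(g₀) = φ̃(g₀)·H(g₀)^{1/2} ≠ 0` as soon as `φ̃(g₀) ≠ 0` (`H(g₀) > 0`). [cite: MoeglinWaldspurger1995, IV.1.11] -/
theorem middlePsi_ne_zero (φt : (quasiSplit F E c N).Adelic → ℂ) {g₀ : (quasiSplit F E c N).Adelic} (h : φt g₀ ≠ 0) :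
    φt g₀ * (((borelHeight g₀ : ℝ≥0) : ℝ) : ℂ) ^ ((1 : ℂ) / 2) ≠ 0 := by
  refine mul_ne_zero h fun h0 => ?_
  rw [Complex.cpow_eq_zero_iff] at h0
  exact (Complex.ofReal_ne_zero.2 (NNReal.coe_pos.2 (borelHeight_pos g₀)).ne') h0.1

end Summit.HodgeConjecture.HodgeConjecture.Cruxes.H413.K2E1ChiBorelConstantTermMiddleResidueCMThree

end
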